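import Literature.NumberTheory.Automorphic.IsomorphismGraphLieTriangular
import HarnessLib

/-!
# The Lie algebra of the graph subgroup, III: all root spaces of `𝔡` are lines; root spaces of `Lie(H)`
(trunk T-AUTOMORPHIC, G25 AutomorphicL; step 5 of the graph proof of `chevalley_isomorphism_abstract`)

Continuation of `IsomorphismGraphLieTriangular.lean` (namespace `Literature.NumberTheory.Automorphic`).
Setting: `(G, T)`, `(G', T')` connected reductive over an algebraically closed field of
characteristic `0` with the same *reduced* root datum `P` (`[P.IsReduced]`; the root datum of a
reductive group is reduced, Springer 7.4.3), a base `b`, and the graph data `T̃`, `ẽ_i`, `f̃_i`,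
`H = H_{b.support}`, `𝔡 = 𝔡_{b.support}` (`IsomorphismGraphGroup.lean`, `…LieGens.lean`). The
previous file showed `𝔡_{±α_s} = k ẽ_s, k f̃_s` for the *simple* roots. Here:

* **Weyl conjugation permutes the weight spaces** (`conj_graphWeyl_mem_grW`): the Weyl element
  `ñ_s ∈ H` normalises `T̃` acting by `s_s` on characters (`graphWeyl_conj_mem`), so `Ad ñ_s`
  carries `(𝔤𝔩)_{χ̃_x}` onto `(𝔤𝔩)_{χ̃_{s_s x}}`; it preserves `𝔡` (`conj_mem_graphLieGen_graphWeyl`)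
  and `Lie(H)`;
* **`𝔡_α = 𝔡 ∩ (𝔤𝔩)_{χ̃_α}` is a line spanned by a vector with both diagonal blocks non-zero, for
  every root `α`** (`isRootLine_root`, by `RootPairing.Base.induction_reflect`: every root of a
  reduced finite root datum is obtained from a simple one by simple reflections and negation) —
  the Lie-algebra form of "the structure is determined by the root datum" (Humphreys, *Lie
  algebras*, 14.2; Steinberg §10), obtained here from the group through its Weyl elements rather
  than from Serre's relations;
* **`Lie(H) ∩ (𝔤𝔩)_{χ̃_α} = 𝔡_α` for every root `α`** (`mem_graphLieGen_of_mem_lieAlgebraGL_graphGroup_root`):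
  for `x = diag(p e_α, q e'_α) ∈ Lie(H)_α` and a spanning vector `D⁻ = diag(c f_α, c' f'_α)` of
  `𝔡_{-α}`, `[x, D⁻] = diag(pc h_α, qc' h'_α)` lies in `𝔡_0 = Lie(T̃)` (`[Lie H, 𝔡] ⊆ 𝔡`), and
  `Lie(T̃)` is a graph, whence `p : q` is the ratio of the spanning vector of `𝔡_α`;
* **the zero weight space of `Lie(H)`** (`tangentDeriv_eq_of_mem_lieAlgebraGL_graphGroup_zero`):
  for `diag(z, z') ∈ Lie(H)^{T̃}` one has `dχ_{α_s}(z) = dχ'_{α_s}(z')` for every simple root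
  (`[diag(z, z'), ẽ_s] ∈ 𝔡_{α_s} = k ẽ_s`), the input of the central-torus argument of the sequel.

Everything is proved; no named fact is introduced.

## References

* [SpringerLAG1998] T. A. Springer, *Linear Algebraic Groups*, 2nd ed. (1998): 7.4.3, 8.1.4,
  Theorem 9.6.2.
* [Humphreys1972] J. E. Humphreys, *Introduction to Lie Algebras and Representation Theory*,
  GTM 9 (1972), §14.2.
* J. E. Humphreys, *Linear Algebraic Groups*, GTM 21 (1975), §32–33.
* R. Steinberg, *Lectures on Chevalley groups*, Yale (1968), §10.
-/

noncomputable section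

open scoped MatrixGroups IsMulCommutative
open Matrix

namespace Literature.NumberTheory.Automorphic

attribute [local instance 100] LieRing.ofAssociativeRing

variable {k : Type*} [Field k] {n n' : Type*} [Fintype n] [DecidableEq n] [Fintype n']
  [DecidableEq n']
variable {ι X Y : Type*} [AddCommGroup X] [AddCommGroup Y]
variable {G T : Subgroup (GL n k)} {G' T' : Subgroup (GL n' k)}
variable [IsMulCommutative ↥T] [IsMulCommutative ↥T']
variable {P : RootPairing ι ℤ X Y}
variable {eX : Additive ↥(characterLattice T) ≃+ X} {eY : Additive ↥(cocharacterLattice T) ≃+ Y}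
variable {eX' : Additive ↥(characterLattice T') ≃+ X} {eY' : Additive ↥(cocharacterLattice T') ≃+ Y}

/-! ### Weyl conjugation permutes the weight spaces -/

section Weyl

variable [IsAlgClosed k] (h : IsRootDatumOf G T P eX eY) (h' : IsRootDatumOf G' T' P eX' eY')
  (hT : IsTorusSubgroup T) (hT' : IsTorusSubgroup T')

omit [IsAlgClosed k] in
/-- A unit and its inverse cancel at the matrix level. [folklore] -/
lemma coe_mul_coe_inv {m : Type*} [Fintype m] [DecidableEq m] (g : GL m k) :
    (g : Matrix m m k) * ((g⁻¹ : GL m k) : Matrix m m k) = 1 := by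
  rw [← Units.val_mul, mul_inv_cancel, Units.val_one]

omit [IsAlgClosed k] in
/-- A unit and its inverse cancel at the matrix level. [folklore] -/
lemma coe_inv_mul_coe {m : Type*} [Fintype m] [DecidableEq m] (g : GL m k) :
    ((g⁻¹ : GL m k) : Matrix m m k) * (g : Matrix m m k) = 1 := by
  rw [← Units.val_mul, inv_mul_cancel, Units.val_one]

omit [IsAlgClosed k] in
/-- Left cancellation `g (g⁻¹ X) = X` at the matrix level. [folklore] -/
lemma coe_mul_inv_mul_cancel {m : Type*} [Fintype m] [DecidableEq m] (g : GL m k) (Z : Matrix m m k) :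
    (g : Matrix m m k) * (((g⁻¹ : GL m k) : Matrix m m k) * Z) = Z := by
  rw [← Matrix.mul_assoc, coe_mul_coe_inv, Matrix.one_mul]

omit [IsAlgClosed k] in
/-- Left cancellation `g⁻¹ (g X) = X` at the matrix level. [folklore] -/
lemma coe_inv_mul_mul_cancel {m : Type*} [Fintype m] [DecidableEq m] (g : GL m k) (Z : Matrix m m k) :
    ((g⁻¹ : GL m k) : Matrix m m k) * ((g : Matrix m m k) * Z) = Z := by
  rw [← Matrix.mul_assoc, coe_inv_mul_coe, Matrix.one_mul]

/-- Conjugation by an element of `T̃` preserves each weight space (it scales weight vectors).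
[folklore] -/
theorem conj_mem_grW_of_mem_graphTorus {s : GL (n ⊕ n') k} (hs : s ∈ graphTorus eX eX' hT hT') {x : X}
    {M : Matrix (n ⊕ n') (n ⊕ n') k} (hM : M ∈ grW eX eX' hT hT' x) :
    (s : Matrix _ _ k) * M * ((s⁻¹ : GL (n ⊕ n') k) : Matrix _ _ k) ∈ grW eX eX' hT hT' x := by
  have e := (mem_weightSpaceGL_iff.1 hM) ⟨s, hs⟩
  rw [← Matrix.coe_units_inv] at e
  change (s : Matrix _ _ k) * M * ((s⁻¹ : GL (n ⊕ n') k) : Matrix _ _ k) = _ at e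
  rw [e]
  exact Submodule.smul_mem _ _ hM

/-- `ñ_s² ∈ T̃`. [cite: SpringerLAG1998, 8.1.4 (ii)] -/
theorem graphWeyl_mul_self_mem_graphTorus (s : ι) :
    graphWeyl h h' s * graphWeyl h h' s ∈ graphTorus eX eX' hT hT' := by
  rw [graphWeyl, ← map_mul, weylSL2_mul_weylSL2]
  exact graphSL2_diagSL2_mem_graphTorus h h' hT hT' s _

/-- **`Ad ñ_s` carries `(𝔤𝔩)_{χ̃_x}` into `(𝔤𝔩)_{χ̃_{s_s x}}`**: `ñ_s` normalises `T̃` and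
`χ̃_y (ñ_s t̃ ñ_s⁻¹) = χ̃_{s_s y} (t̃)` (`graphWeyl_conj_mem`). [cite: SpringerLAG1998, 8.1.4 (i)–(ii)] -/
theorem conj_graphWeyl_mem_grW (s : ι) {x : X} {M : Matrix (n ⊕ n') (n ⊕ n') k} (hM : M ∈ grW eX eX' hT hT' x) :
    ((graphWeyl h h' s : GL (n ⊕ n') k) : Matrix _ _ k) * M *
        (((graphWeyl h h' s)⁻¹ : GL (n ⊕ n') k) : Matrix _ _ k) ∈ grW eX eX' hT hT' (P.reflection s x) := by
  set m : GL (n ⊕ n') k := graphWeyl h h' s with hm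
  rw [grW, mem_weightSpaceGL_iff]
  intro t
  -- `t' = m⁻¹ t m ∈ T̃` and `χ̃_x (t') = χ̃_{s x} (t)`
  have hnorm := graphWeyl_mem_normalizer h h' hT hT' s
  have ht' : m⁻¹ * (t : GL (n ⊕ n') k) * m ∈ graphTorus eX eX' hT hT' := by
    have := (Subgroup.mem_normalizer_iff.1 (Subgroup.inv_mem _ hnorm)) (t : GL (n ⊕ n') k)
    rw [inv_inv] at this
    exact this.1 t.2
  obtain ⟨hconj, hchar⟩ := graphWeyl_conj_mem h h' hT hT' s ht'
  have e1 : graphWeyl h h' s * (m⁻¹ * (t : GL (n ⊕ n') k) * m) * (graphWeyl h h' s)⁻¹ = t := by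
    rw [← hm]; group
  have key : graphChar eX eX' hT hT' x ⟨_, ht'⟩ = graphChar eX eX' hT hT' (P.reflection s x) t := by
    have e := hchar (P.reflection s x)
    rw [RootPairing.reflection_same] at e
    rw [← e]
    congr 1
    exact Subtype.ext e1
  -- the computation
  have hMt := (mem_weightSpaceGL_iff.1 hM) ⟨_, ht'⟩
  change ((m⁻¹ * (t : GL (n ⊕ n') k) * m : GL (n ⊕ n') k) : Matrix _ _ k) * M *
    ((m⁻¹ * (t : GL (n ⊕ n') k) * m : GL (n ⊕ n') k) : Matrix _ _ k)⁻¹ = _ at hMt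
  rw [key] at hMt
  have eL : ((t : GL (n ⊕ n') k) : Matrix _ _ k) * ((m : Matrix _ _ k) * M * ((m⁻¹ : GL (n ⊕ n') k) : Matrix _ _ k)) *
      ((t : GL (n ⊕ n') k) : Matrix _ _ k)⁻¹ =
      (m : Matrix _ _ k) * (((m⁻¹ * (t : GL (n ⊕ n') k) * m : GL (n ⊕ n') k) : Matrix _ _ k) * M *
        ((m⁻¹ * (t : GL (n ⊕ n') k) * m : GL (n ⊕ n') k) : Matrix _ _ k)⁻¹) * ((m⁻¹ : GL (n ⊕ n') k) : Matrix _ _ k) := by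
    rw [← Matrix.coe_units_inv, ← Matrix.coe_units_inv]
    simp only [_root_.mul_inv_rev, inv_inv, Units.val_mul, Matrix.mul_assoc, coe_mul_inv_mul_cancel,
      coe_mul_coe_inv, Matrix.mul_one]
  rw [eL, hMt, Matrix.mul_smul, Matrix.smul_mul]

/-- **`Ad ñ_s⁻¹` carries `(𝔤𝔩)_{χ̃_x}` into `(𝔤𝔩)_{χ̃_{s_s x}}`** as well (`ñ_s⁻¹ = ñ_s⁻² ñ_s` with
`ñ_s² ∈ T̃`). [cite: SpringerLAG1998, 8.1.4 (i)–(ii)] -/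
theorem conj_graphWeyl_inv_mem_grW (s : ι) {x : X} {M : Matrix (n ⊕ n') (n ⊕ n') k} (hM : M ∈ grW eX eX' hT hT' x) :
    (((graphWeyl h h' s)⁻¹ : GL (n ⊕ n') k) : Matrix _ _ k) * M *
        ((graphWeyl h h' s : GL (n ⊕ n') k) : Matrix _ _ k) ∈ grW eX eX' hT hT' (P.reflection s x) := by
  set m : GL (n ⊕ n') k := graphWeyl h h' s with hm
  have h1 := conj_graphWeyl_mem_grW h h' hT hT' s hM
  rw [← hm] at h1
  have h2 := conj_mem_grW_of_mem_graphTorus hT hT' (Subgroup.inv_mem _ (graphWeyl_mul_self_mem_graphTorus h h' hT hT' s)) h1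
  rw [← hm] at h2
  have e : (((m * m)⁻¹ : GL (n ⊕ n') k) : Matrix _ _ k) * ((m : Matrix _ _ k) * M * ((m⁻¹ : GL (n ⊕ n') k) : Matrix _ _ k)) *
      ((((m * m)⁻¹)⁻¹ : GL (n ⊕ n') k) : Matrix _ _ k) = ((m⁻¹ : GL (n ⊕ n') k) : Matrix _ _ k) * M * (m : Matrix _ _ k) := by
    simp only [_root_.mul_inv_rev, inv_inv, Units.val_mul, Matrix.mul_assoc, coe_inv_mul_mul_cancel]
  rw [e] at h2
  exact h2

end Weyl

/-! ### Every root space of `𝔡` is a line -/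

section RootLines

variable [IsAlgClosed k] [CharZero k] (h : IsRootDatumOf G T P eX eY) (h' : IsRootDatumOf G' T' P eX' eY')
  (b : P.Base) (hG : IsConnectedReductive G) (hTm : IsMaximalTorusIn T G)
  (hG' : IsConnectedReductive G') (hTm' : IsMaximalTorusIn T' G')

/-- The property "*`𝔡 ∩ (𝔤𝔩)_{χ̃_x}` is a line spanned by a vector with both diagonal blocks
non-zero*" for a weight `x`. [folklore] -/
def IsRootLine (x : X) : Prop :=
  ∃ D : Matrix (n ⊕ n') (n ⊕ n') k, D ∈ graphLieGen h h' hTm.2.1 hTm'.2.1 (b.support : Set ι) ∧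
    D ∈ grW eX eX' hTm.2.1 hTm'.2.1 x ∧ D.toBlocks₁₁ ≠ 0 ∧ D.toBlocks₂₂ ≠ 0 ∧
    ∀ M : Matrix (n ⊕ n') (n ⊕ n') k, M ∈ graphLieGen h h' hTm.2.1 hTm'.2.1 (b.support : Set ι) →
      M ∈ grW eX eX' hTm.2.1 hTm'.2.1 x → ∃ c : k, M = c • D

include hG hG' in
/-- **The simple roots**: `𝔡_{α_s} = k ẽ_s`. [cite: Humphreys1972, 18.2] -/
theorem isRootLine_simple (s : ↥b.support) : IsRootLine h h' b hTm hTm' (P.root (s : ι)) :=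
  ⟨graphE h h' s, graphE_mem_graphLieGen h h' _ _ _ s.2, graphE_mem_weightSpaceGL h h' _ _ s,
    by rw [toBlocks₁₁_graphE]; exact h.rootE_ne_zero s, by rw [toBlocks₂₂_graphE]; exact h'.rootE_ne_zero s,
    fun _ hM hw => exists_eq_smul_graphE_of_mem_graphLieGen h h' b hG hTm hG' hTm' s hM hw⟩

include hG hG' in
/-- **The negatives of the simple roots**: `𝔡_{-α_s} = k f̃_s`. [cite: Humphreys1972, 18.2] -/
theorem isRootLine_neg_simple (s : ↥b.support) : IsRootLine h h' b hTm hTm' (-P.root (s : ι)) :=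
  ⟨graphF h h' s, graphF_mem_graphLieGen h h' _ _ _ s.2, graphF_mem_weightSpaceGL h h' _ _ s,
    by rw [toBlocks₁₁_graphF]; exact h.rootF_ne_zero s, by rw [toBlocks₂₂_graphF]; exact h'.rootF_ne_zero s,
    fun _ hM hw => exists_eq_smul_graphF_of_mem_graphLieGen h h' b hG hTm hG' hTm' s hM hw⟩

omit [IsAlgClosed k] [CharZero k] in
/-- Conjugating a block-diagonal matrix by `ñ_s` gives a block-diagonal matrix with conjugate
blocks. [folklore] -/
lemma graphWeyl_conj_fromBlocks (s : ι) (A : Matrix n n k) (A' : Matrix n' n' k) :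
    ((graphWeyl h h' s : GL (n ⊕ n') k) : Matrix _ _ k) * fromBlocks A 0 0 A' *
        (((graphWeyl h h' s)⁻¹ : GL (n ⊕ n') k) : Matrix _ _ k) =
      fromBlocks ((((h.rootSL2 s weylSL2 : ↥G) : GL n k) : Matrix n n k) * A *
          ((((h.rootSL2 s weylSL2 : ↥G) : GL n k)⁻¹ : GL n k) : Matrix n n k)) 0 0
        ((((h'.rootSL2 s weylSL2 : ↥G') : GL n' k) : Matrix n' n' k) * A' *
          ((((h'.rootSL2 s weylSL2 : ↥G') : GL n' k)⁻¹ : GL n' k) : Matrix n' n' k)) := by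
  rw [graphWeyl, graphSL2_apply, blockDiagGL_conj_fromBlocks]

omit [IsAlgClosed k] [CharZero k] in
/-- Conjugation by a unit kills no non-zero matrix. [folklore] -/
lemma conj_ne_zero {m : Type*} [Fintype m] [DecidableEq m] (g : GL m k) {A : Matrix m m k} (hA : A ≠ 0) :
    (g : Matrix m m k) * A * ((g⁻¹ : GL m k) : Matrix m m k) ≠ 0 := by
  intro h0
  apply hA
  have : ((g⁻¹ : GL m k) : Matrix m m k) * ((g : Matrix m m k) * A * ((g⁻¹ : GL m k) : Matrix m m k)) * (g : Matrix m m k) = A := by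
    simp only [Matrix.mul_assoc, coe_inv_mul_coe, Matrix.mul_one, coe_inv_mul_mul_cancel]
  rw [← this, h0, Matrix.mul_zero, Matrix.zero_mul]

include hG hG' in
/-- **The reflection step**: if `𝔡_x` is a good line then so is `𝔡_{s_s x}` for a simple `s`
(conjugate by the Weyl element `ñ_s ∈ H`). [cite: SpringerLAG1998, 8.1.4] -/
theorem isRootLine_reflection {x : X} (hx : IsRootLine h h' b hTm hTm' x) (s : ↥b.support) :
    IsRootLine h h' b hTm hTm' (P.reflection s x) := by
  have hGa : IsAlgebraicSubgroup G := hG.1.1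
  have hGa' : IsAlgebraicSubgroup G' := hG'.1.1
  obtain ⟨D, hD𝔡, hDw, hD₁, hD₂, huniq⟩ := hx
  have hD := eq_fromBlocks_of_mem_lieAlgebraGL_of_le (graphGroup_le_prodBlock h h' hTm.2.1 hTm'.2.1 _)
    (graphLieGen_le h h' hTm.2.1 hTm'.2.1 _ hD𝔡)
  have hb₁ : ((graphWeyl h h' s : GL (n ⊕ n') k) : Matrix _ _ k) * D *
      (((graphWeyl h h' s)⁻¹ : GL (n ⊕ n') k) : Matrix _ _ k) =
      fromBlocks ((((h.rootSL2 s weylSL2 : ↥G) : GL n k) : Matrix n n k) * D.toBlocks₁₁ *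
          ((((h.rootSL2 s weylSL2 : ↥G) : GL n k)⁻¹ : GL n k) : Matrix n n k)) 0 0
        ((((h'.rootSL2 s weylSL2 : ↥G') : GL n' k) : Matrix n' n' k) * D.toBlocks₂₂ *
          ((((h'.rootSL2 s weylSL2 : ↥G') : GL n' k)⁻¹ : GL n' k) : Matrix n' n' k)) := by
    conv_lhs => rw [hD.1]
    exact graphWeyl_conj_fromBlocks h h' s _ _
  unfold IsRootLine
  refine ⟨((graphWeyl h h' s : GL (n ⊕ n') k) : Matrix _ _ k) * D * (((graphWeyl h h' s)⁻¹ : GL (n ⊕ n') k) : Matrix _ _ k),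
    ?_, ?_, ?_, ?_, ?_⟩
  · exact conj_mem_graphLieGen_graphWeyl h h' hTm.2.1 hTm'.2.1 (b.support : Set ι) hGa hGa' s.2 hD𝔡
  · exact conj_graphWeyl_mem_grW h h' hTm.2.1 hTm'.2.1 (s : ι) hDw
  · rw [hb₁, toBlocks_fromBlocks₁₁]
    exact conj_ne_zero _ hD₁
  · rw [hb₁, toBlocks_fromBlocks₂₂]
    exact conj_ne_zero _ hD₂
  · intro M hM hMw
    -- `m⁻¹ M m ∈ 𝔡_x`
    have hN𝔡 : (((graphWeyl h h' s)⁻¹ : GL (n ⊕ n') k) : Matrix _ _ k) * M * ((graphWeyl h h' s : GL (n ⊕ n') k) : Matrix _ _ k) ∈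
        graphLieGen h h' hTm.2.1 hTm'.2.1 (b.support : Set ι) := by
      have := conj_mem_graphLieGen h h' hTm.2.1 hTm'.2.1 _ hGa hGa'
        (Subgroup.inv_mem _ (graphWeyl_mem_graphGroup h h' hTm.2.1 hTm'.2.1 _ s.2)) hM
      rwa [inv_inv] at this
    have hNw : (((graphWeyl h h' s)⁻¹ : GL (n ⊕ n') k) : Matrix _ _ k) * M * ((graphWeyl h h' s : GL (n ⊕ n') k) : Matrix _ _ k) ∈
        grW eX eX' hTm.2.1 hTm'.2.1 x := by
      have := conj_graphWeyl_inv_mem_grW h h' hTm.2.1 hTm'.2.1 s hMw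
      rwa [RootPairing.reflection_same] at this
    obtain ⟨c, hc⟩ := huniq _ hN𝔡 hNw
    refine ⟨c, ?_⟩
    have e : M = ((graphWeyl h h' s : GL (n ⊕ n') k) : Matrix _ _ k) *
        ((((graphWeyl h h' s)⁻¹ : GL (n ⊕ n') k) : Matrix _ _ k) * M * ((graphWeyl h h' s : GL (n ⊕ n') k) : Matrix _ _ k)) *
        (((graphWeyl h h' s)⁻¹ : GL (n ⊕ n') k) : Matrix _ _ k) := by
      simp only [Matrix.mul_assoc, coe_mul_coe_inv, Matrix.mul_one, coe_mul_inv_mul_cancel]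
    rw [e, hc, Matrix.mul_smul, Matrix.smul_mul]

variable [Finite ι] [P.IsReduced]

include hG hG' in
/-- **Every root space of `𝔡` is a line spanned by a vector with both blocks non-zero**
(`RootPairing.Base.induction_reflect`: simple roots, simple reflections, negation).
[cite: Humphreys1972, 14.2] -/
theorem isRootLine_root (j : ι) : IsRootLine h h' b hTm hTm' (P.root j) := by
  suffices hp : IsRootLine h h' b hTm hTm' (P.root j) ∧ IsRootLine h h' b hTm hTm' (-P.root j) from hp.1
  refine b.induction_reflect j (p := fun j => IsRootLine h h' b hTm hTm' (P.root j) ∧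
    IsRootLine h h' b hTm hTm' (-P.root j)) ?_ ?_ ?_
  · rintro i ⟨h1, h2⟩
    rw [RootPairing.root_reflectionPerm, RootPairing.reflection_apply_self, neg_neg]
    exact ⟨h2, h1⟩
  · intro i hi
    exact ⟨isRootLine_simple h h' b hG hTm hG' hTm' ⟨i, hi⟩, isRootLine_neg_simple h h' b hG hTm hG' hTm' ⟨i, hi⟩⟩
  · rintro i s ⟨h1, h2⟩ hs
    rw [RootPairing.root_reflectionPerm]
    refine ⟨isRootLine_reflection h h' b hG hTm hG' hTm' h1 ⟨s, hs⟩, ?_⟩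
    rw [← map_neg]
    exact isRootLine_reflection h h' b hG hTm hG' hTm' h2 ⟨s, hs⟩

include hG hG' in
/-- The same for the negative of a root (which is a root). [cite: Humphreys1972, 14.2] -/
theorem isRootLine_neg_root (j : ι) : IsRootLine h h' b hTm hTm' (-P.root j) := by
  rw [← RootPairing.reflection_apply_self, ← RootPairing.root_reflectionPerm]
  exact isRootLine_root h h' b hG hTm hG' hTm' _

/-! ### The root spaces of `Lie(H)` are those of `𝔡` -/

include hG hG' in
/-- **`Lie(H) ∩ (𝔤𝔩)_{χ̃_α} = 𝔡_α` for every root `α`.** Let `x = diag(p e_α, q e'_α) ∈ Lie(H)_α`,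
`D = diag(a e_α, a' e'_α)` span `𝔡_α` and `D⁻ = diag(c f_α, c' f'_α)` span `𝔡_{-α}` (all four
scalars `a, a', c, c'` non-zero). Then `a' [x, D⁻] - q [D, D⁻] ∈ 𝔡_0 = Lie(T̃)` has vanishing second
block, hence vanishes (`Lie(T̃)` is a graph), and its first block `(a' p c - q a c) h_α` gives
`a' p = q a`, i.e. `x = (p/a) D`. [cite: Humphreys1972, 14.2] -/
theorem mem_graphLieGen_of_mem_lieAlgebraGL_graphGroup_root (j : ι) {M : Matrix (n ⊕ n') (n ⊕ n') k}
    (hM : M ∈ lieAlgebraGL (graphGroup h h' hTm.2.1 hTm'.2.1 (b.support : Set ι)))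
    (hMw : M ∈ grW eX eX' hTm.2.1 hTm'.2.1 (P.root j)) :
    M ∈ graphLieGen h h' hTm.2.1 hTm'.2.1 (b.support : Set ι) := by
  have hGa : IsAlgebraicSubgroup G := hG.1.1
  have hGa' : IsAlgebraicSubgroup G' := hG'.1.1
  -- the spanning vectors
  obtain ⟨D, hD𝔡, hDw, hD₁, hD₂, -⟩ := isRootLine_root h h' b hG hTm hG' hTm' j
  obtain ⟨Dm, hDm𝔡, hDmw, hDm₁, -, -⟩ := isRootLine_neg_root h h' b hG hTm hG' hTm' j
  -- their shapes
  obtain ⟨a, a', hDe⟩ := mem_lieAlgebraGL_graphGroup_weight_root eX eX' h h' hG hTm hG' hTm'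
    (graphLieGen_le h h' _ _ _ hD𝔡) hDw
  obtain ⟨c, c', hDme⟩ := mem_lieAlgebraGL_graphGroup_weight_neg_root eX eX' h h' hG hTm hG' hTm'
    (graphLieGen_le h h' _ _ _ hDm𝔡) hDmw
  obtain ⟨p, q, hMe⟩ := mem_lieAlgebraGL_graphGroup_weight_root eX eX' h h' hG hTm hG' hTm' hM hMw
  have ha : a ≠ 0 := by
    rintro rfl; apply hD₁; rw [hDe, toBlocks_fromBlocks₁₁, zero_smul]
  have hc : c ≠ 0 := by
    rintro rfl; apply hDm₁; rw [hDme, toBlocks_fromBlocks₁₁, zero_smul]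
  -- the two brackets, in `𝔡_0 = Lie T̃`
  have hB₁ : M * Dm - Dm * M ∈ lieAlgebraGL (graphTorus eX eX' hTm.2.1 hTm'.2.1) := by
    refine mem_lieAlgebraGL_graphTorus_of_mem_graphLieGen h h' b hG hTm hG' hTm'
      (lie_mem_graphLieGen_of_mem_lieAlgebraGL h h' _ _ _ hGa hGa' hM hDm𝔡) ?_
    have := lie_mem_grW eX eX' hTm.2.1 hTm'.2.1 hMw hDmw
    rwa [add_neg_cancel] at this
  have hB₂ : D * Dm - Dm * D ∈ lieAlgebraGL (graphTorus eX eX' hTm.2.1 hTm'.2.1) := by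
    refine mem_lieAlgebraGL_graphTorus_of_mem_graphLieGen h h' b hG hTm hG' hTm'
      (lie_mem_graphLieGen_of_mem_lieAlgebraGL h h' _ _ _ hGa hGa' (graphLieGen_le h h' _ _ _ hD𝔡) hDm𝔡) ?_
    have := lie_mem_grW eX eX' hTm.2.1 hTm'.2.1 hDw hDmw
    rwa [add_neg_cancel] at this
  -- explicit forms of the brackets
  have eB₁ : M * Dm - Dm * M = fromBlocks ((p * c) • h.rootH j) 0 0 ((q * c') • h'.rootH j) := by
    rw [hMe, hDme, fromBlocks_commutator, smul_mul_smul_comm, smul_mul_smul_comm, mul_comm c p, ← smul_sub,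
      h.lie_rootE_rootF, smul_mul_smul_comm, smul_mul_smul_comm, mul_comm c' q, ← smul_sub, h'.lie_rootE_rootF]
  have eB₂ : D * Dm - Dm * D = fromBlocks ((a * c) • h.rootH j) 0 0 ((a' * c') • h'.rootH j) := by
    rw [hDe, hDme, fromBlocks_commutator, smul_mul_smul_comm, smul_mul_smul_comm, mul_comm c a, ← smul_sub,
      h.lie_rootE_rootF, smul_mul_smul_comm, smul_mul_smul_comm, mul_comm c' a', ← smul_sub, h'.lie_rootE_rootF]
  -- the combination with vanishing second block
  have hC : a' • (M * Dm - Dm * M) - q • (D * Dm - Dm * D) ∈ lieAlgebraGL (graphTorus eX eX' hTm.2.1 hTm'.2.1) :=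
    Submodule.sub_mem _ (Submodule.smul_mem _ _ hB₁) (Submodule.smul_mem _ _ hB₂)
  have hC0 := eq_zero_of_mem_lieAlgebraGL_graphTorus_of_toBlocks₂₂ eX eX' hTm.2.1 hTm'.2.1 hC (by
    rw [eB₁, eB₂, fromBlocks_smul, fromBlocks_smul, sub_eq_add_neg, fromBlocks_neg, fromBlocks_add,
      toBlocks_fromBlocks₂₂, smul_smul, smul_smul, ← sub_eq_add_neg, ← sub_smul]
    ring_nf; rw [zero_smul])
  have hfirst : (a' * (p * c) - q * (a * c)) • h.rootH j = 0 := by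
    have := congrArg Matrix.toBlocks₁₁ hC0
    rw [eB₁, eB₂, fromBlocks_smul, fromBlocks_smul, sub_eq_add_neg, fromBlocks_neg, fromBlocks_add,
      toBlocks_fromBlocks₁₁, smul_smul, smul_smul, ← sub_eq_add_neg, ← sub_smul] at this
    rw [this]
    rfl
  have hrel : a' * p = q * a := by
    have h0 : a' * (p * c) - q * (a * c) = 0 := by
      rcases smul_eq_zero.1 hfirst with h0 | h0
      · exact h0
      · exact absurd h0 (h.rootH_ne_zero j)
    have : (a' * p - q * a) * c = 0 := by rw [← h0]; ring
    exact sub_eq_zero.1 ((mul_eq_zero.1 this).resolve_right hc)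
  -- conclude `M = (p / a) • D`
  have hq : p / a * a' = q := by
    field_simp
    linear_combination hrel
  have hMD : M = (p / a) • D := by
    rw [hMe, hDe, fromBlocks_smul, smul_smul, smul_smul, smul_zero, smul_zero, div_mul_cancel₀ _ ha, hq]
  rw [hMD]
  exact (graphLieGen h h' hTm.2.1 hTm'.2.1 _).smul_mem _ hD𝔡

include hG hG' in
/-- **The root spaces of `Lie(H)`, explicitly**: an element of `Lie(H)` of weight `χ̃_α` is a
multiple of the spanning vector of `𝔡_α`, which has both blocks non-zero; in particular an element
of `Lie(H)_α` with vanishing first (or second) block vanishes. [cite: Humphreys1972, 14.2] -/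
theorem eq_zero_of_mem_lieAlgebraGL_graphGroup_root_of_toBlocks (j : ι) {M : Matrix (n ⊕ n') (n ⊕ n') k}
    (hM : M ∈ lieAlgebraGL (graphGroup h h' hTm.2.1 hTm'.2.1 (b.support : Set ι)))
    (hMw : M ∈ grW eX eX' hTm.2.1 hTm'.2.1 (P.root j)) (h0 : M.toBlocks₁₁ = 0 ∨ M.toBlocks₂₂ = 0) : M = 0 := by
  obtain ⟨D, hD𝔡, hDw, hD₁, hD₂, huniq⟩ := isRootLine_root h h' b hG hTm hG' hTm' j
  obtain ⟨c, rfl⟩ := huniq M (mem_graphLieGen_of_mem_lieAlgebraGL_graphGroup_root h h' b hG hTm hG' hTm' j hM hMw) hMw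
  have hc : c = 0 := by
    rcases h0 with h0 | h0
    · have : c • D.toBlocks₁₁ = 0 := by
        have := h0; rwa [show (c • D).toBlocks₁₁ = c • D.toBlocks₁₁ from by ext; rfl] at this
      exact (smul_eq_zero.1 this).resolve_right hD₁
    · have : c • D.toBlocks₂₂ = 0 := by
        have := h0; rwa [show (c • D).toBlocks₂₂ = c • D.toBlocks₂₂ from by ext; rfl] at this
      exact (smul_eq_zero.1 this).resolve_right hD₂
  rw [hc, zero_smul]

/-! ### The zero weight space of `Lie(H)` -/

omit [Finite ι] [P.IsReduced] in
include hG hG' in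
/-- **On `Lie(H)^{T̃}` the differentials of the simple roots agree on the two blocks**: for
`diag(z, z') ∈ Lie(H)` of weight `0` and a simple root `α_s`, `dχ_{α_s}(z) = dχ'_{α_s}(z')` (for any
polynomials `p`, `p'` representing `χ_{α_s}` on `T` and `χ'_{α_s}` on `T'`): the bracket
`[diag(z, z'), ẽ_s] = diag(dχ_{α_s}(z) e_s, dχ'_{α_s}(z') e'_s)` lies in `𝔡_{α_s} = k ẽ_s`.
[cite: Humphreys1972, 14.2] -/
theorem tangentDeriv_eq_of_mem_lieAlgebraGL_graphGroup_zero {A : Matrix (n ⊕ n') (n ⊕ n') k}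
    (hA : A ∈ lieAlgebraGL (graphGroup h h' hTm.2.1 hTm'.2.1 (b.support : Set ι)))
    (hw : A ∈ grW eX eX' hTm.2.1 hTm'.2.1 0) (s : ↥b.support)
    {p : MvPolynomial (GLCoord n) k} (hp : ∀ t : ↥T, ((charOfWeight eX (P.root (s : ι)) t : kˣ) : k) =
      MvPolynomial.eval (glCoordFun (t : GL n k)) p)
    {p' : MvPolynomial (GLCoord n') k} (hp' : ∀ t : ↥T', ((charOfWeight eX' (P.root (s : ι)) t : kˣ) : k) =
      MvPolynomial.eval (glCoordFun (t : GL n' k)) p') :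
    tangentDeriv p A.toBlocks₁₁ = tangentDeriv p' A.toBlocks₂₂ := by
  have hGa : IsAlgebraicSubgroup G := hG.1.1
  have hGa' : IsAlgebraicSubgroup G' := hG'.1.1
  obtain ⟨eA, hz, hz'⟩ := mem_lieAlgebraGL_graphGroup_weight_zero eX eX' h h' hG hTm hG' hTm' hA hw
  -- `[A, ẽ_s] ∈ 𝔡_{α_s} = k ẽ_s`
  have hBr : A * graphE h h' s - graphE h h' s * A ∈ graphLieGen h h' hTm.2.1 hTm'.2.1 (b.support : Set ι) :=
    lie_mem_graphLieGen_of_mem_lieAlgebraGL h h' _ _ _ hGa hGa' hA (graphE_mem_graphLieGen h h' _ _ _ s.2)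
  have hBw : A * graphE h h' s - graphE h h' s * A ∈ grW eX eX' hTm.2.1 hTm'.2.1 (P.root (s : ι)) := by
    have := lie_mem_grW eX eX' hTm.2.1 hTm'.2.1 hw (graphE_mem_weightSpaceGL h h' hTm.2.1 hTm'.2.1 s)
    rwa [zero_add] at this
  obtain ⟨c, hc⟩ := exists_eq_smul_graphE_of_mem_graphLieGen h h' b hG hTm hG' hTm' s hBr hBw
  -- compute the bracket blockwise
  have e1 : A.toBlocks₁₁ * h.rootE s - h.rootE s * A.toBlocks₁₁ = tangentDeriv p A.toBlocks₁₁ • h.rootE s :=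
    lie_eq_tangentDeriv_smul_of_mem_weightSpaceGL hp (h.rootE_mem s).2 hz
  have e2 : A.toBlocks₂₂ * h'.rootE s - h'.rootE s * A.toBlocks₂₂ = tangentDeriv p' A.toBlocks₂₂ • h'.rootE s :=
    lie_eq_tangentDeriv_smul_of_mem_weightSpaceGL hp' (h'.rootE_mem s).2 hz'
  rw [eA, graphE, fromBlocks_commutator, e1, e2, fromBlocks_smul, smul_zero, smul_zero, fromBlocks_inj] at hc
  obtain ⟨hc1, -, -, hc2⟩ := hc
  have h1 : tangentDeriv p A.toBlocks₁₁ = c := smul_left_injective k (h.rootE_ne_zero s) hc1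
  have h2 : tangentDeriv p' A.toBlocks₂₂ = c := smul_left_injective k (h'.rootE_ne_zero s) hc2
  rw [h1, h2]

end RootLines

end Literature.NumberTheory.Automorphic

end
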